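import Summits.AtomisticToContinuum.Crystallization.Theses.ChessboardParticlePlanes
import Summits.AtomisticToContinuum.Crystallization.Theorems.PhononSlackCertificatesPeriodicGivenLayered

/-!
# Crux `PeriodicWindows` (stmt-AtomisticToContinuum-3240) — ALTERNATIVE line `laminar-layered` (crux-strategist s1)

Registered with `--alt`; it does not touch the live line `Lines/Sketch.lean`. This is the TWO-PIECE cut of the crux along the route
thesis ("the summit weight moves to LAMINARITY and to a planar problem"), and it is at the same time the typed record of the split
package attached as evidence on 3240 (`children.json` + `ChessboardParticlePlanesPeriodicWindowsSplit.lean`):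

* STUB 1 `stub_oneLaminarWindow` — one `η`-laminar particle-centred closed `L`-window at every scale, frequently in `N`, along every
  Lennard-Jones ground-state sequence. BOARD INPUT: it is the certified residual S9♭ of THIS ROUTE's crux stmt-6711 `LjLaminarWindows`,
  EQUIVALENT to it by the tree theorem `LjLaminarWindowsSketch.LjLaminarWindows_iff_oneWindowAllScales` (not importable next to
  `…PeriodicGivenLayered`: the modules `MuGSC` / `MuGroundStateConfiguration` both declare `UniformlyDiscrete`).
* STUB 2 `stub_layeredOfLaminarWindows` — stub 1 implies the layered windows of route HullMinimality (item stmt-11778, consequent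
  verbatim: one spacing `a ∈ [47/50,1]`, FREE Hägg word, FREE gaps in `[39a/50, 17a/20]`, one window per scale frequently in `N`).
  The planar/registry half of conjunct (ii); by the landed `LjLaminarWindows_of_oneWindow` its prover may take the laminar windows
  `7/10`-separated and bulk-like (internal energy `≤ 2(⨅_Q e(Q)+ε)·#window`). The finer `ε = 0` hull form of this stub, with cohesion
  made explicit, is line `dense-laminar-hull`.
* COMPOSITION `PeriodicWindows_of` — modus ponens + the LANDED stacking selection `LayeredHull.PeriodicGivenLayered_of` (item 11779).
-/

noncomputable section

namespace Summit.AtomisticToContinuum.Crystallization.Cruxes.PeriodicWindows.LaminarLayered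

open Literature.MathematicalPhysics.StatisticalMechanics Filter Metric
open Summit.AtomisticToContinuum.Crystallization.Theses.ChessboardParticlePlanes (PeriodicWindows)

/-- STUB 1 (board input ≡ item stmt-6711 up to the landed iff `LjLaminarWindows_iff_oneWindowAllScales`): along every sequence of
Lennard-Jones ground states, for every `η > 0` and every radius `L`, frequently in `N`, some particle `i`, linear isometry `A` and
`3/4`-separated height set `T` make the closed `L`-ball around `x i` `η`-laminar in the rotated third coordinate. -/
theorem stub_oneLaminarWindow :
    ∀ x : (N : ℕ) → (Fin N → EuclideanSpace ℝ (Fin 3)), (∀ N, IsGroundState lennardJones (x N)) → ∀ η : ℝ, 0 < η → ∀ L : ℝ, ∃ᶠ N in Filter.atTop, ∃ (i : Fin N) (A : EuclideanSpace ℝ (Fin 3) →ₗᵢ[ℝ] EuclideanSpace ℝ (Fin 3)) (T : Set ℝ), (∀ t ∈ T, ∀ t' ∈ T, t ≠ t' → (3 : ℝ) / 4 ≤ |t - t'|) ∧ (∀ j : Fin N, dist (x N j) (x N i) ≤ L → ∃ t ∈ T, |(A (x N j - x N i)) 2 - t| ≤ η) := by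
  sorry

/-- STUB 2 (the new content: laminar ⇒ layered): one laminar window per scale along every ground-state sequence (stub 1) implies the
layered windows of item stmt-11778 along every ground-state sequence — triangular layers of one spacing `a ∈ [47/50, 1]`, free Hägg
word, free interlayer gaps in `[39a/50, 17a/20]`, one window per scale frequently in `N`. -/
theorem stub_layeredOfLaminarWindows :
    (∀ x : (N : ℕ) → (Fin N → EuclideanSpace ℝ (Fin 3)), (∀ N, IsGroundState lennardJones (x N)) → ∀ η : ℝ, 0 < η → ∀ L : ℝ, ∃ᶠ N in Filter.atTop, ∃ (i : Fin N) (A : EuclideanSpace ℝ (Fin 3) →ₗᵢ[ℝ] EuclideanSpace ℝ (Fin 3)) (T : Set ℝ), (∀ t ∈ T, ∀ t' ∈ T, t ≠ t' → (3 : ℝ) / 4 ≤ |t - t'|) ∧ (∀ j : Fin N, dist (x N j) (x N i) ≤ L → ∃ t ∈ T, |(A (x N j - x N i)) 2 - t| ≤ η)) → ∀ x : (N : ℕ) → (Fin N → EuclideanSpace ℝ (Fin 3)), (∀ N, IsGroundState lennardJones (x N)) → ∃ a : ℝ, 47 / 50 ≤ a ∧ a ≤ 1 ∧ ∀ R ε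 : ℝ, 0 < ε → ∃ᶠ N in Filter.atTop, ∃ (A : EuclideanSpace ℝ (Fin 3) →ₗᵢ[ℝ] EuclideanSpace ℝ (Fin 3)) (t : EuclideanSpace ℝ (Fin 3)) (s : ℤ → ℤ) (z : ℤ → ℝ), IsHaggSeq s ∧ (∀ m : ℤ, 39 / 50 * a ≤ z (m + 1) - z m ∧ z (m + 1) - z m ≤ 17 / 20 * a) ∧ let S : Set (EuclideanSpace ℝ (Fin 3)) := {p | ∃ m i j : ℤ, p = A (((i : ℝ) • triangularVec₁ a) + ((j : ℝ) • triangularVec₂ a) + ((haggLabel s m : ℝ) • barlowOffset a) + (z m • layerNormal 1))}; (∀ p ∈ S, ‖p‖ ≤ R → ∃ i : Fin N, dist (x N i + t) p ≤ ε) ∧ (∀ i : Fin N, ‖x N i + t‖ ≤ R → ∃ p ∈ S, dist (x N i + t) p ≤ ε) := by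
  sorry

/-- COMPOSITION (checked, no `sorry` of its own): the crux BY NAME from the two stubs through the landed `PeriodicGivenLayered_of`. -/
theorem PeriodicWindows_of : PeriodicWindows := by
  intro x hx
  have hpgl := Summit.AtomisticToContinuum.Crystallization.Theorems.LayeredHull.PeriodicGivenLayered_of
  unfold Summit.AtomisticToContinuum.Crystallization.Theses.PhononSlackCertificates.PeriodicGivenLayered at hpgl
  exact hpgl x hx (stub_layeredOfLaminarWindows stub_oneLaminarWindow x hx)

end Summit.AtomisticToContinuum.Crystallization.Cruxes.PeriodicWindows.LaminarLayered

end
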